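import Summits.QuantumFields.YangMills.Theorems.BalabanUVNodesN15CurvedLocalCoefLettersOfReg335UN
import Summits.QuantumFields.YangMills.Theorems.BalabanUVNodesN15PerCubeGreenFineObjects
import HarnessLib

/-!
# N15 = NE2, road (c) — PROGRAMME (PC) «[B9] Sect. C FOR THE LANDAU LETTER WITH PER-CUBE GAUGES (3.35) AS PRINTED», (PC-E) (C6-b): THE FINE POINTWISE LETTERS OF n15-c∕340 AND A
# GLOBALLY UNITARY CUBE GAUGE FROM ONE `Reg335Cube` DATUM PER CUBE — dag-n15-w2's operator-norm letters of the class, read in the gauge extended by `1` off the cube (dag-n15-c g32, n15-c∕342)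

Cell `pub-ymgap`, seat `pub-ymgap-dag-n15-c` (generation g32; R134 (a) seat, strategy s1 «first missing estimate»; HUMAN RULING D-0062; chair R424 venue).
`bears_on: R4∕N15 · K3⁸ SpineGivenEndpointR13SepCoPHV (stmt-QuantumFields-27366)`; filed `--kind proof --supports stmt-QuantumFields-27366 --as helper` — COUNT-NEUTRAL.
THEOREMS only, 0 `def`, 0 `sorry`; bookkeeping over dag-n15-w2's landed letters.  Imports BY NAME dag-n15-w2 g6 `…CurvedLocalCoefLettersOfReg335UN` (through it g5 `…CurvedLocalSpeciesOfReg335UN`: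
★★ `uN_opLetters_of_gauge335` (unitarity of the class gauge on the cube and the two operator-norm letters `‖U^u_κ(z) − 1‖ ≤ η(C∕ξ)e^{ηC∕ξ}`, `‖U^u_ν(z+e_κ) − U^u_ν(z)‖ ≤ η²(C∕ξ²)e^{ηC∕ξ}`),
`uN_val_gaugeTr_eq`, `uN_mem_unitaryGroup_of_norm_le_one`; lit-balaban r06 `B9Eq335RegularityClasses.Reg335Cube` = [B9] (3.35) on a cube) and n15-c∕260′ `…PerCubeGreenFineObjects` (the
fine site carrier `ScX′`, `scShift′`).  Nothing in the tree is modified, no landed name re-declared.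

WHY.  n15-c∕340 `uN_idef_scGreen_tr` displays, per cube `k`, a unitary fine gauge `u′_k` (unitary EVERYWHERE) and the two pointwise letters of the transformed fine bond variables
`V′_μ(z) = u′_k(z)U′_μ(z)u′_k(z+e′_μ)ᴴ` on a set `Qf k`: `‖V′_μ(z) − 1‖ ≤ η′p`, `‖V′_μ(z) − V′_μ(z − e′_μ)‖ ≤ η′²q`.  THIS FILE produces both from the PRINTED class: ★★ `uN_exists_gauge_pointLetters_of_reg335Cube`
(generic carrier `X`, shifts `τ`): `Reg335Cube τ U η Q ξ C` ⟹ a gauge `w`, unitary everywhere (the class's `u` on `Q`, `1` off `Q` — dag-n15-w2's `Set.piecewise` extension), with the first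
letter at every `z ∈ Q` with `τ_μ z ∈ Q` and the second at every `z` with `z, τ_μ z, τ_μ⁻¹ z ∈ Q`, `p = (C∕ξ)e^{ηC∕ξ}`, `q = (C∕ξ²)e^{ηC∕ξ}`; ★★ `uN_exists_cubeGauges_pointLetters_of_reg335Cube`:
the `K`-indexed family on the (PC) fine site carrier in 340's binder shapes (`hu′`, `hF1`, `hF2` on the one-step interiors `{z ∈ Q k | z ± e′_μ ∈ Q k}`).

HONEST FRAMING ∕ LIMITS.  Bookkeeping over dag-n15-w2's letters (operator norm on `M_n(ℂ)`, `Matrix.instL2OpNormedRing`); the class datum is the caller's; nothing of [B9] asserted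
((3.35) p.396 = the class's definition, r06).  NE2⁺ NOT PRINTED, NOT proved; N15 of record untouched (DISCHARGED AS CONSUMED, p687738); K3⁸ OPEN; counts of record UNMOVED (typed 28∕28
· discharged 8∕27); one finite 𝕋⁴ at fixed ε per index — NOT infinite volume, NOT OS on ℝ⁴, NOT a mass gap, NOT Clay.  Restate-immune (no Theses import).
-/

set_option autoImplicit false

noncomputable section

open scoped BigOperators Matrix Matrix.Norms.L2Operator

namespace Summit.QuantumFields.YangMills.BalabanUVNodes.N15.CurvedSpecies

open Literature.MathematicalPhysics.QuantumFieldTheory.Balaban1983to89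
open Literature.MathematicalPhysics.QuantumFieldTheory.Balaban1983to89.B9Eq3117Current (gaugeTr)
open Literature.MathematicalPhysics.QuantumFieldTheory.Balaban1983to89.B9Eq335RegularityClasses (Reg335Cube)

/-! ## §1 Generic carrier: a globally unitary gauge with the two pointwise operator-norm letters -/

section Generic

variable {n : Type} [Fintype n] [DecidableEq n] [Nonempty n] {X J : Type} (τ : J → X ≃ X) (U : J → X → (Matrix n n ℂ)ˣ)

/-- ★★ **FROM THE CLASS (3.35) ON A SET: A GAUGE UNITARY EVERYWHERE WITH THE TWO POINTWISE LETTERS OF THE TRANSFORMED BOND VARIABLES** — `Reg335Cube τ U η Q ξ C` (`η > 0`; `U` arbitrary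
units) ⟹ ∃ `w : X → M_n(ℂ)`, `w(y)ᴴw(y) = 1` for ALL `y` (the class's gauge on `Q`, `1` off `Q`), such that `V_μ(z) := w(z)U_μ(z)w(τ_μz)ᴴ` satisfies `‖V_μ(z) − 1‖ ≤ η·(C∕ξ)e^{ηC∕ξ}`
whenever `z, τ_μz ∈ Q`, and `‖V_μ(z) − V_μ(τ_μ⁻¹z)‖ ≤ η²·(C∕ξ²)e^{ηC∕ξ}` whenever `τ_μ⁻¹z, z, τ_μz ∈ Q` (dag-n15-w2 `uN_opLetters_of_gauge335` read in the extension).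
[cite: Balaban1985BackgroundPropagators, (3.35) p.396, Cor. 3.6 p.408] -/
theorem uN_exists_gauge_pointLetters_of_reg335Cube {η : ℝ} (hη : 0 < η) {Q : Set X} {ξ C : ℝ}
    (h : Reg335Cube τ U η Q ξ C) :
    ∃ w : X → Matrix n n ℂ, (∀ y, (w y)ᴴ * w y = 1) ∧
      (∀ μ z, z ∈ Q → τ μ z ∈ Q → ‖w z * (U μ z : Matrix n n ℂ) * (w (τ μ z))ᴴ - 1‖ ≤ η * ((C / ξ) * Real.exp (η * (C / ξ)))) ∧
      (∀ μ z, (τ μ).symm z ∈ Q → z ∈ Q → τ μ z ∈ Q →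
        ‖w z * (U μ z : Matrix n n ℂ) * (w (τ μ z))ᴴ - w ((τ μ).symm z) * (U μ ((τ μ).symm z) : Matrix n n ℂ) * (w (τ μ ((τ μ).symm z)))ᴴ‖ ≤ η ^ 2 * ((C / ξ ^ 2) * Real.exp (η * (C / ξ)))) := by
  classical
  obtain ⟨u, A, hu1, hg, hA, hD⟩ := h
  obtain ⟨huQ, h1, h2⟩ := uN_opLetters_of_gauge335 (T := τ) U (cube := Q) hη hu1 hg hA hD
  refine ⟨Q.piecewise (fun z => (u z : Matrix n n ℂ)) (fun _ => 1), fun y => ?_, fun μ z hz hz' => ?_, fun μ z hzm hz hz' => ?_⟩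
  · by_cases hy : y ∈ Q
    · rw [Set.piecewise_eq_of_mem _ _ _ hy]; exact Matrix.mem_unitaryGroup_iff'.mp (huQ y hy)
    · rw [Set.piecewise_eq_of_notMem _ _ _ hy, Matrix.conjTranspose_one, Matrix.mul_one]
  · rw [Set.piecewise_eq_of_mem _ _ _ hz, Set.piecewise_eq_of_mem _ _ _ hz', ← uN_val_gaugeTr_eq (T := τ) U (huQ (τ μ z) hz')]
    exact (h1 μ z hz).trans (le_of_eq (mul_assoc _ _ _))
  · have hzz : τ μ ((τ μ).symm z) = z := Equiv.apply_symm_apply _ _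
    have eg : (gaugeTr τ u U μ ((τ μ).symm z) : Matrix n n ℂ) = (u ((τ μ).symm z) : Matrix n n ℂ) * (U μ ((τ μ).symm z) : Matrix n n ℂ) * ((u z : Matrix n n ℂ))ᴴ := by
      have h0 := uN_val_gaugeTr_eq (T := τ) U (κ := μ) (z := (τ μ).symm z) (by rw [hzz]; exact huQ z hz)
      rw [hzz] at h0
      exact h0
    rw [hzz, Set.piecewise_eq_of_mem _ _ _ hz, Set.piecewise_eq_of_mem _ _ _ hz', Set.piecewise_eq_of_mem _ _ _ hzm,
      ← uN_val_gaugeTr_eq (T := τ) U (huQ (τ μ z) hz'), ← eg]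
    have h := h2 μ μ ((τ μ).symm z) hzm (by rw [hzz]; exact hz)
    rw [hzz] at h
    exact h.trans (le_of_eq (mul_assoc _ _ _))

end Generic

/-! ## §2 The (PC) fine site carrier: n15-c∕340's `hu′`, `hF1`, `hF2` from one `Reg335Cube` datum per cube -/

section Sites

open Summit.QuantumFields.YangMills.BalabanUVNodes.N15.Gluing (ScX' scShift')

variable {d : ℕ} {L : ℕ} [NeZero L] {mv kk r : ℕ} {hL : Odd L ∧ 1 < L} {n : Type} [Fintype n] [DecidableEq n] [Nonempty n]

/-- ★★ **n15-c∕340's FINE LETTERS FROM THE PRINTED CLASS, PER CUBE**: a fine bond field `U′` (units) in `Reg335Cube (· + e′_μ) U′ η′ (Q k) ξ C` for every cube `k` (`η′ = (L^rL^k)^{−1}`)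
⟹ per-cube gauges `u′_k`, unitary EVERYWHERE, with 340's `hF1` (`‖V′ − 1‖ ≤ η′p`, `p = (C∕ξ)e^{η′C∕ξ}`) and `hF2` (`‖V′(z) − V′(z−e′_μ)‖ ≤ η′²q`, `q = (C∕ξ²)e^{η′C∕ξ}`) on the one-step interiors
`Qf k = {z ∈ Q k | ∀ μ, z + e′_μ ∈ Q k ∧ z − e′_μ ∈ Q k}`. [cite: Balaban1985BackgroundPropagators, (3.35) p.396, Cor. 3.6 p.408] -/
theorem uN_exists_cubeGauges_pointLetters_of_reg335Cube (U' : Fin (d + 1) → ScX' d L mv kk r hL → (Matrix n n ℂ)ˣ)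
    (Q : (Fin (d + 1) → ZMod (2 * L)) → Set (ScX' d L mv kk r hL)) {ξ C : ℝ} (h335 : ∀ k, Reg335Cube (scShift' d L mv kk r hL) U' ((((L ^ r * L ^ kk : ℕ) : ℝ))⁻¹) (Q k) ξ C) :
    ∃ u' : (Fin (d + 1) → ZMod (2 * L)) → ScX' d L mv kk r hL → Matrix n n ℂ, (∀ k z, (u' k z)ᴴ * u' k z = 1) ∧
      (∀ k μ z, z ∈ {z | z ∈ Q k ∧ ∀ μ, scShift' d L mv kk r hL μ z ∈ Q k ∧ (scShift' d L mv kk r hL μ).symm z ∈ Q k} →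
        ‖u' k z * (U' μ z : Matrix n n ℂ) * (u' k (scShift' d L mv kk r hL μ z))ᴴ - 1‖ ≤ ((((L ^ r * L ^ kk : ℕ) : ℝ))⁻¹) * ((C / ξ) * Real.exp (((((L ^ r * L ^ kk : ℕ) : ℝ))⁻¹) * (C / ξ)))) ∧
      (∀ k μ z, z ∈ {z | z ∈ Q k ∧ ∀ μ, scShift' d L mv kk r hL μ z ∈ Q k ∧ (scShift' d L mv kk r hL μ).symm z ∈ Q k} →
        ‖u' k z * (U' μ z : Matrix n n ℂ) * (u' k (scShift' d L mv kk r hL μ z))ᴴ -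
            u' k ((scShift' d L mv kk r hL μ).symm z) * (U' μ ((scShift' d L mv kk r hL μ).symm z) : Matrix n n ℂ) * (u' k (scShift' d L mv kk r hL μ ((scShift' d L mv kk r hL μ).symm z)))ᴴ‖ ≤
          ((((L ^ r * L ^ kk : ℕ) : ℝ))⁻¹) ^ 2 * ((C / ξ ^ 2) * Real.exp (((((L ^ r * L ^ kk : ℕ) : ℝ))⁻¹) * (C / ξ)))) := by
  have hη : (0 : ℝ) < ((((L ^ r * L ^ kk : ℕ) : ℝ))⁻¹) :=
    inv_pos.mpr (Nat.cast_pos.mpr (Nat.mul_pos (pow_pos (Nat.pos_of_ne_zero (NeZero.ne L)) r) (pow_pos (Nat.pos_of_ne_zero (NeZero.ne L)) kk)))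
  choose w hwu hw1 hw2 using fun k => uN_exists_gauge_pointLetters_of_reg335Cube (scShift' d L mv kk r hL) U' hη (h335 k)
  exact ⟨w, fun k z => hwu k z, fun k μ z hz => hw1 k μ z hz.1 (hz.2 μ).1, fun k μ z hz => hw2 k μ z (hz.2 μ).2 hz.1 (hz.2 μ).1⟩

end Sites

end Summit.QuantumFields.YangMills.BalabanUVNodes.N15.CurvedSpecies

end
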